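import Mathlib
import HarnessLib
import Summits.AtomisticToContinuum.Crystallization.Theorems.FrustratedLawDichotomyAperiodicFrustratedLawGapErgodicSubsequence
import Summits.AtomisticToContinuum.Crystallization.Theorems.FrustratedLawDichotomyAperiodicFrustratedLawGapErgodicAtoms

/-!
# Ergodic reduction for the crux `AperiodicFrustratedLawGap` — an ergodicity criterion for conditional laws

Route `FrustratedLawDichotomy`, crux `AperiodicFrustratedLawGap` (item `stmt-AtomisticToContinuum-27623`),
registered stub `stub_ergodicReduction` (skeleton `dd3251ad731e`); step S5 of the `hErg` plan, GENERIC PART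
(pure measure theory on a standard Borel probability space `(Ω, Q)` with a sub-σ-algebra `m` whose events are
exactly the measurable sets with a property `p`, think: invariance under re-rooting).

Let `κ = condExpKernel Q m` be the conditional laws, `c : ℕ → Set Ω` a countable generating π-system of
measurable sets, `u j n` measurable "Cesàro averages" of the indicators `1_{c j}` converging in `L²(Q)` to
`m`-measurable limits `v j`, and suppose that for `Q`-a.e. `ω` the same averages converge in `L²(κ_ω)` to SOME
measurable `G` with `∫_I G dκ_ω = κ_ω(c j ∩ I)` for every measurable `I` with `p I` (a mean ergodic theorem for the
conditional law).  Then `Q`-a.e. conditional law is `p`-TRIVIAL: `κ_ω(B) = 0 ∨ κ_ω(Bᶜ) = 0` for every measurable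
`B` with `p B`.  Proof (Kallenberg FMP3 Lemma 10.25 pattern): along one subsequence all `u j` converge `Q`-a.e.,
hence `κ_ω`-a.e. for a.e. `ω`; the `m`-measurable `v j` are `κ_ω`-a.s. equal to `v j ω`
(`ae_condExpKernel_levelSet_eq_one`); so the local limits are a.s. constant, which gives
`κ_ω(c j ∩ I) = κ_ω(c j) κ_ω(I)` for all `j` and all invariant `I`, i.e. `κ_ω|_I = κ_ω(I) κ_ω` on the π-system,
hence everywhere; evaluating at `Iᶜ` gives `κ_ω(I) κ_ω(Iᶜ) = 0`.

* `ae_ae_condExpKernel_of_ae` — `Q`-a.e. properties hold `κ_ω`-a.e. for `Q`-a.e. `ω`;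
* `ae_condExpKernel_trivial_of_tendsto` — the criterion above.

`[folklore]` (Kallenberg, *Foundations of Modern Probability* (3rd ed.), Lemma 10.25 / Thm 10.26).
-/

noncomputable section

namespace Summit.AtomisticToContinuum.Crystallization.Theorems.FrustratedLawDichotomyErgodicReduction

open MeasureTheory Set Filter ProbabilityTheory Topology
open scoped ENNReal

section Generic

variable {Ω : Type*} {m : MeasurableSpace Ω} [mΩ : MeasurableSpace Ω] [StandardBorelSpace Ω]
  {Q : Measure Ω} [IsProbabilityMeasure Q]

/-- **`Q`-almost sure properties hold almost surely under almost every conditional law**: if `P` holds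
`Q`-a.e., then for `Q`-a.e. `ω` it holds `condExpKernel Q m ω`-a.e. (`Q` is the `Q`-mixture of its conditional
laws). [folklore] -/
theorem ae_ae_condExpKernel_of_ae (hm : m ≤ mΩ) {P : Ω → Prop} (h : ∀ᵐ x ∂Q, P x) :
    ∀ᵐ ω ∂Q, ∀ᵐ x ∂(condExpKernel Q m ω), P x := by
  have hκ : Measurable (condExpKernel Q m : Ω → Measure Ω) :=
    (condExpKernel Q m).measurable.mono hm le_rfl
  have hbind : Q.bind (condExpKernel Q m) = Q := by
    have h1 := restrict_eq_bind_condExpKernel (Q := Q) hm (@MeasurableSet.univ Ω m)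
    rw [Measure.restrict_univ] at h1
    exact h1.symm
  have h' : ∀ᵐ x ∂(Q.bind (condExpKernel Q m)), P x := by rwa [hbind]
  exact ae_of_ae_map hκ.aemeasurable (Measure.ae_ae_of_ae_join h')

/-- **Ergodicity of almost every conditional law — a criterion.**  Let `Q` be a probability measure on a
standard Borel space, `m` a sub-σ-algebra whose events are exactly the measurable sets with property `p`,
`κ = condExpKernel Q m`, `c : ℕ → Set Ω` measurable sets forming a generating π-system, `u j n` measurable
functions converging in `L²(Q)` to `m`-measurable `v j`, and suppose that for `Q`-a.e. `ω` and every `j` the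
`u j n` converge in `L²(κ_ω)` to a measurable `G` with `∫_I G dκ_ω = ∫_I 1_{c j} dκ_ω` for all measurable `I` with
`p I`.  Then for `Q`-a.e. `ω`, `κ_ω B = 0 ∨ κ_ω Bᶜ = 0` for every measurable `B` with `p B`. [folklore] -/
theorem ae_condExpKernel_trivial_of_tendsto (hm : m ≤ mΩ) {p : Set Ω → Prop}
    (hmiff : ∀ B : Set Ω, MeasurableSet[m] B ↔ (MeasurableSet B ∧ p B))
    {c : ℕ → Set Ω} (hc : ∀ j, MeasurableSet (c j))
    (hgen : mΩ = MeasurableSpace.generateFrom (Set.range c)) (hpi : IsPiSystem (Set.range c))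
    {u : ℕ → ℕ → Ω → ℝ} (hu : ∀ j n, Measurable (u j n))
    {v : ℕ → Ω → ℝ} (hv : ∀ j, Measurable[m] (v j))
    (hlim : ∀ j, Tendsto (fun n => eLpNorm (u j n - v j) 2 Q) atTop (𝓝 0))
    (hloc : ∀ᵐ ω ∂Q, ∀ j, ∃ G : Ω → ℝ, Measurable G ∧
      (∀ I : Set Ω, MeasurableSet I → p I →
        ∫ x in I, G x ∂(condExpKernel Q m ω) =
          ∫ x in I, (c j).indicator (fun _ => (1 : ℝ)) x ∂(condExpKernel Q m ω)) ∧
      Tendsto (fun n => eLpNorm (u j n - G) 2 (condExpKernel Q m ω)) atTop (𝓝 0)) :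
    ∀ᵐ ω ∂Q, ∀ B : Set Ω, MeasurableSet B → p B →
      condExpKernel Q m ω B = 0 ∨ condExpKernel Q m ω Bᶜ = 0 := by
  -- `univ` is an `m`-event, so it has property `p`
  have hpuniv : p univ := ((hmiff univ).1 (@MeasurableSet.univ Ω m)).2
  -- S2: one subsequence along which all `u j` converge `Q`-a.e., transferred to the conditional laws
  obtain ⟨ns, hns, hae⟩ :=
    exists_subseq_forall_ae_tendsto (ν := Q) hu (fun j => (hv j).mono hm le_rfl) hlim
  have h1 := ae_ae_condExpKernel_of_ae hm hae
  -- S3: the conditional laws sit on the joint level sets of the `v j`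
  have h2 := ae_condExpKernel_levelSet_eq_one (Q := Q) hm hv
  filter_upwards [h1, h2, hloc] with ω h1ω h2ω hlocω
  set κ : Measure Ω := condExpKernel Q m ω with hκ_def
  haveI : IsProbabilityMeasure κ := by rw [hκ_def]; infer_instance
  -- the `v j` are `κ`-a.s. constant
  have hlevel : MeasurableSet {ω' | ∀ i, v i ω' = v i ω} := by
    rw [Set.setOf_forall]
    exact MeasurableSet.iInter fun i => measurableSet_eq_fun ((hv i).mono hm le_rfl) measurable_const
  have hconst : ∀ᵐ x ∂κ, ∀ i, v i x = v i ω := by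
    have h0 : κ {ω' | ∀ i, v i ω' = v i ω}ᶜ = 0 := (prob_compl_eq_zero_iff hlevel).2 h2ω
    filter_upwards [measure_eq_zero_iff_ae_notMem.1 h0] with x hx
    simpa only [mem_compl_iff, mem_setOf_eq, not_not] using hx
  -- S4: the local limits coincide with the global ones, hence are a.s. constant
  choose G hGm hGI hGlim using hlocω
  obtain ⟨ns', hns', hae'⟩ := exists_subseq_forall_ae_tendsto (ν := κ) (u := fun j k => u j (ns k)) (v := G)
    (fun j k => hu j (ns k)) hGm (fun j => (hGlim j).comp hns.tendsto_atTop)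
  have hGconst : ∀ᵐ x ∂κ, ∀ j, G j x = v j ω := by
    filter_upwards [h1ω, hconst, hae'] with x hx1 hx2 hx3
    intro j
    rw [← hx2 j]
    exact tendsto_nhds_unique (hx3 j) ((hx1 j).comp hns'.tendsto_atTop)
  -- `κ (c j ∩ I) = κ I * v j ω` for every invariant measurable `I`
  have hreal : ∀ (j : ℕ) (I : Set Ω), MeasurableSet I → p I → κ.real (c j ∩ I) = κ.real I * v j ω := by
    intro j I hI hpI
    have hL : ∫ x in I, G j x ∂κ = κ.real I * v j ω := by
      rw [setIntegral_congr_ae (g := fun _ => v j ω) hI (hGconst.mono fun x hx _ => hx j),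
        setIntegral_const, smul_eq_mul]
    have hR : ∫ x in I, (c j).indicator (fun _ => (1 : ℝ)) x ∂κ = κ.real (c j ∩ I) := by
      rw [integral_indicator (hc j), Measure.restrict_restrict (hc j), setIntegral_const, smul_eq_mul,
        mul_one]
    rw [← hR, ← hGI j I hI hpI, hL]
  -- in particular `κ (c j) = v j ω`, so `κ (c j ∩ I) = κ I * κ (c j)`
  have hcj : ∀ j : ℕ, κ.real (c j) = v j ω := by
    intro j
    have h := hreal j univ MeasurableSet.univ hpuniv
    rwa [inter_univ, probReal_univ, one_mul] at h
  have hprod : ∀ (j : ℕ) (I : Set Ω), MeasurableSet I → p I → κ (c j ∩ I) = κ I * κ (c j) := by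
    intro j I hI hpI
    have h : κ.real (c j ∩ I) = κ.real I * κ.real (c j) := by rw [hreal j I hI hpI, hcj j]
    rw [measureReal_def, measureReal_def, measureReal_def, ← ENNReal.toReal_mul] at h
    exact (ENNReal.toReal_eq_toReal_iff' (measure_ne_top κ _)
      (ENNReal.mul_ne_top (measure_ne_top κ _) (measure_ne_top κ _))).1 h
  -- S5: `κ|_B = κ(B) • κ` on the π-system, hence everywhere; evaluate at `Bᶜ`
  intro B hB hpB
  have hext : κ.restrict B = κ B • κ := by
    refine ext_of_generate_finite (Set.range c) hgen hpi ?_ ?_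
    · rintro _ ⟨j, rfl⟩
      rw [Measure.restrict_apply (hc j), Measure.smul_apply, smul_eq_mul, hprod j B hB hpB]
    · rw [Measure.restrict_apply MeasurableSet.univ, univ_inter, Measure.smul_apply, smul_eq_mul,
        measure_univ, mul_one]
  have h0 : κ B * κ Bᶜ = 0 := by
    have h : (κ.restrict B) Bᶜ = (κ B • κ) Bᶜ := by rw [hext]
    rw [Measure.restrict_apply hB.compl, Set.compl_inter_self, measure_empty, Measure.smul_apply,
      smul_eq_mul] at h
    exact h.symm
  exact mul_eq_zero.1 h0

end Generic

end Summit.AtomisticToContinuum.Crystallization.Theorems.FrustratedLawDichotomyErgodicReduction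

end
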